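import Summits.FinalStateConjecture.FinalStateConjecture.Theses.TangentConeAtIPlus

/-!
# Route TangentConeAtIPlus · item `Assembly` (stmt-FinalStateConjecture-17672; rev ≤ 2: stmt-10181)

Pure logic. The route decl
`Summit.FinalStateConjecture.FinalStateConjecture.Theses.TangentConeAtIPlus.Assembly` reads, since the
route repair rev 3 (2026-08-16, after the T2 re-type p126844 of the Statement),
`FiniteKerrParticleCone → KerrCaptureOnRays → ConeCompletesScri → DecoratedConeExhausts →
SettledExteriorHoldsRays → FinalStateConjecture`, which is verbatim the type of the route's (sorry-free)
deciding theorem `Theses.TangentConeAtIPlus.closes`. (Rev ≤ 2 it was the four-antecedent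
`K1 → K2 → K3 → K4 → FinalStateConjecture`, item stmt-10181, proved here by the same name at p-commit
360292163840; the restate kept this theorem's TYPE — the route decl by name — and broke only its proof,
re-done below against rev 3: dependency-drift repair 2026-08-17.)

Content of the implication (Dafermos–Luk arXiv:1710.01722, p. 8; Christodoulou CQG 16 (1999),
p. A24 for genericity by positive codimension): Christodoulou genericity
`IsChristodoulouGeneric 𝓓 P 1` is ANTITONE in the exceptional set `{D ∈ 𝓓 | ¬ P D}` — the
one-parameter family through an exceptional datum of the weaker property serves verbatim for the
stronger one; since the T2 re-type the genericity is the TAME one, `IsTameChristodoulouGeneric 𝓓 P 1`,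
and the same end `e` and family `F` serve — so it suffices that the cone property of
`FiniteKerrParticleCone` implies the Statement's property POINTWISE on admissible data: given an
admissible `D` with an MGHD and cone data `(N, (Λᵢ,cᵢ), σᵢ, dᵢ, T, U, Φ)` on every MGHD `𝒟`,
`ConeCompletesScri` gives `HasCompleteNullInfinity 𝒟`, `KerrCaptureOnRays` gives hole data
`(Mᵢ, aᵢ, τ₀, Ψᵢ)`, `DecoratedConeExhausts` turns cone + hole data into the sub-extremal, future-oriented
`FinalStateDecomposition` of the self-determined exterior with `HasExhaustiveCharts`, and
`SettledExteriorHoldsRays` supplies the ray clause `RaysStayInClosure`. The `let`-bound predicates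
`Cone` / `Holes` are textually identical across the items, so the implications compose definitionally.
No hypothesis beyond the five displayed ones enters.

The proof is written out (rather than `exact closes`) so that this file carries its own kernel
evidence of the composition; it uses only the five route decls and the Statement. This module
imports the route module, so the closure is recorded as a docstring link in the Theses file
(no `Assembly_holds` re-import; docs/reference/gate.md §4.2).
-/

-- `Summit.FinalStateConjecture.FinalStateConjecture.…` is the tree's mandated namespace (summit = sub-problem,
-- D-0017); the Summits library builds with `weak.linter.dupNamespace = false` (lakefile), mirrored here for `lean check`.
set_option linter.dupNamespace false

namespace Summit.FinalStateConjecture.FinalStateConjecture.Theorems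

open Literature.Geometry.Lorentzian
open scoped Manifold ContDiff

/-- **Item `Assembly` (stmt-FinalStateConjecture-17672), route TangentConeAtIPlus.**
`FiniteKerrParticleCone → KerrCaptureOnRays → ConeCompletesScri → DecoratedConeExhausts →
SettledExteriorHoldsRays → FinalStateConjecture`: generic cone data at `i⁺` (K1), Kerr capture on the
rays (K2), completeness of `𝓘⁺` from the cone (K3), exhaustion of the self-determined exterior by the
decorated cone (K4) and the ray clause of the settled exterior (K5) imply the Final State Conjecture as
typed in `Summits/FinalStateConjecture/FinalStateConjecture/Statement.lean` (T2 re-type). Proof: tame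
Christodoulou genericity `IsTameChristodoulouGeneric 𝓓 P 1` is monotone in the property `P` (antitone
in the exceptional set: the end and the tame injective admissible one-parameter family through an
exceptional datum of the stronger property, supplied by K1, work verbatim), and pointwise on admissible
data with an MGHD, for every MGHD `𝒟` with cone data, K3 gives complete `𝓘⁺`, K2 the hole data, K4 the
sub-extremal, future-oriented, exhaustive `FinalStateDecomposition` with `O = exteriorOf 𝒟 d.charted`
and K5 `RaysStayInClosure 𝒟 O` — the same composition as the route's deciding theorem
`Theses.TangentConeAtIPlus.closes`. (Same name and type as the rev-≤-2 landing for stmt-10181; only the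
proof was re-done after the rev-3 restate added K5.) [cite: DafermosLuk2017, Conjecture 1]
[cite: Christodoulou1999, p. A24] -/
theorem TangentConeAtIPlus.assembly_proof :
    Summit.FinalStateConjecture.FinalStateConjecture.Theses.TangentConeAtIPlus.Assembly := by
  unfold Summit.FinalStateConjecture.FinalStateConjecture.Theses.TangentConeAtIPlus.Assembly
  intro h₁ h₂ h₃ h₄ h₅ X _ _ _ _ _ _
  -- tame Christodoulou genericity is antitone in the exceptional set: a pointwise implication on the
  -- admissible class transfers it from the cone property `P` to the Statement's property `Q`
  -- (the same end `e` and the same family `F` serve)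
  have mono : ∀ (P Q : InitialDataSet (𝓡 3) X → Prop),
      (∀ D ∈ admissibleVacuumData X, P D → Q D) →
      InitialDataSet.IsTameChristodoulouGeneric (admissibleVacuumData X) P 1 →
      InitialDataSet.IsTameChristodoulouGeneric (admissibleVacuumData X) Q 1 := by
    intro P Q hPQ hP d hd
    obtain ⟨e, F, hF, hI, h0, hinj, hmem, hE⟩ := hP d ⟨hd.1, fun h ↦ hd.2 (hPQ d hd.1 h)⟩
    exact ⟨e, F, hF, hI, h0, hinj, hmem, fun c hc hc' ↦ hE c hc ⟨hc'.1, fun h ↦ hc'.2 (hPQ _ hc'.1 h)⟩⟩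
  refine mono _ _ ?_ (h₁ X)
  -- pointwise on admissible data: MGHD existence is carried over; for every MGHD with cone data,
  -- K3 gives complete 𝓘⁺, K2 the hole data, K4 the oriented exhaustive sub-extremal decomposition,
  -- K5 the ray clause
  rintro D hD ⟨hex, hall⟩
  refine ⟨hex, fun 𝒟 h𝒟 ↦ ?_⟩
  obtain ⟨N, mo, σ, dr, T, U, Φ, hcone⟩ := hall 𝒟 h𝒟
  have hscri : Summit.FinalStateConjecture.HasCompleteNullInfinity 𝒟.toCauchyDevelopment :=
    h₃ X D hD 𝒟 h𝒟 N mo σ dr T U Φ hcone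
  refine ⟨hscri, ?_⟩
  obtain ⟨M, a, τ₀, Ψ, hholes⟩ := h₂ X D hD 𝒟 h𝒟 N mo σ dr T U Φ hcone
  obtain ⟨O, fd, hsub, hO, hexh, hfo⟩ := h₄ X D hD 𝒟 h𝒟 N mo σ dr T U Φ hcone M a τ₀ Ψ hholes
  exact ⟨O, fd, hsub, hO, h₅ X D hD 𝒟 h𝒟 hscri O fd hsub hO hexh hfo, hexh, hfo⟩

end Summit.FinalStateConjecture.FinalStateConjecture.Theorems
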